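import Mathlib
import Literature.Probability.Process.RootedHardCoreConfig
import HarnessLib

/-!
# `GappedShellCensus.RadialDefectsVanish` (stmt-AtomisticToContinuum-15930), line `all-twelve-gap`:
# COMPACTNESS — `ThickThirteen → AllTwelveGap → ∃ n, LTG_n` (registered stub `stub_ltgOfAllTwelveGap`, PROVED by name + signature)

Pure analysis in the compact local-rubber space `LocalConfig ℝ³` (`Literature/Probability/Process/LocalRubber*`).
If the finite locally-twelve gap statement `LTG_n` failed at every locality radius `n + 2`, root the offending cluster at
`0`, truncate it to the `(n+2)`-ball and pass to a local-rubber limit `Y` along a subsequence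
(`LocalConfig.exists_tendsto_subseq`; rooted `55/57`-hard-core configurations are a closed class,
`LocalConfig.isClosed_setOf_rooted_separated`).  `Y` is `55/57`-separated, contains `0`, is locally finite
(`LocalConfig.finite_inter_of_separated`); matching plus finite stabilisation transfers "twelve other sites within `1`"
to every site of `Y`, `ThickThirteen` caps the count at twelve, so `AllTwelveGap` applies to `Y`; the annulus neighbours of
the roots are matched to a thirteenth site of `Y` of norm `≤ 1` (contradicting `ThickThirteen`) or of norm in `(1, 21/17]`
(contradicting `AllTwelveGap`).  Standalone (imports `Mathlib`, the local-rubber library, `HarnessLib` only).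
-/

noncomputable section

open scoped BigOperators Topology Classical
open Filter Metric
open Literature.Probability.Process

namespace Summit.AtomisticToContinuum.Crystallization.Theorems

namespace RdvAtg

/-! ### Finite stabilisation -/

/-- A finite set of reals leaves a gap above every threshold: for some `η > 0`, no element lies in `(ρ, ρ + η]`. -/
theorem exists_gap_of_finite {F : Set ℝ} (hF : F.Finite) (ρ : ℝ) :
    ∃ η : ℝ, 0 < η ∧ ∀ d ∈ F, d ≤ ρ + η → d ≤ ρ := by
  by_cases hne : (hF.toFinset.filter fun d => ρ < d).Nonempty
  · have hm : ρ < (hF.toFinset.filter fun d => ρ < d).min' hne :=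
      (Finset.mem_filter.1 ((hF.toFinset.filter fun d => ρ < d).min'_mem hne)).2
    refine ⟨((hF.toFinset.filter fun d => ρ < d).min' hne - ρ) / 2, by linarith, fun d hd hdle => ?_⟩
    by_contra hlt
    have hdG : d ∈ (hF.toFinset.filter fun d => ρ < d) :=
      Finset.mem_filter.2 ⟨hF.mem_toFinset.2 hd, not_le.1 hlt⟩
    have := (hF.toFinset.filter fun d => ρ < d).min'_le d hdG
    linarith
  · refine ⟨1, one_pos, fun d hd hdle => ?_⟩
    by_contra hlt
    exact hne ⟨d, Finset.mem_filter.2 ⟨hF.mem_toFinset.2 hd, not_le.1 hlt⟩⟩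

/-! ### Transfer of a finite pattern through a matching -/

/-- If every point of `T` in the `R`-ball has a point of `Y` within `η`, `T` is `s`-separated and `2η < s`, then a finite
set of points of `T` in the `R`-ball is matched INJECTIVELY into `Y`. -/
theorem transfer_finset {Y T : Set (EuclideanSpace ℝ (Fin 3))} {R η s : ℝ} (hηs : 2 * η < s)
    (hT : ∀ x ∈ T, ∀ x' ∈ T, x ≠ x' → s ≤ dist x x')
    (hm : ∀ p ∈ T, ‖p‖ ≤ R → ∃ q ∈ Y, dist q p ≤ η)
    (Q' : Finset (EuclideanSpace ℝ (Fin 3))) (hQ' : ∀ q' ∈ Q', q' ∈ T ∧ ‖q'‖ ≤ R) :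
    ∃ Q : Finset (EuclideanSpace ℝ (Fin 3)), Q.card = Q'.card ∧ ∀ q ∈ Q, q ∈ Y ∧ ∃ q' ∈ Q', dist q q' ≤ η := by
  have hch : ∀ q' : Q', ∃ q ∈ Y, dist q (q' : (EuclideanSpace ℝ (Fin 3))) ≤ η := fun q' =>
    hm q' (hQ' q' q'.2).1 (hQ' q' q'.2).2
  choose g hgY hgd using hch
  have hinj : Function.Injective g := by
    intro a b hab
    apply Subtype.ext
    by_contra hne
    have hs := hT a (hQ' a a.2).1 b (hQ' b b.2).1 hne
    have : dist (a : (EuclideanSpace ℝ (Fin 3))) b ≤ 2 * η :=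
      calc dist (a : (EuclideanSpace ℝ (Fin 3))) b ≤ dist (a : (EuclideanSpace ℝ (Fin 3))) (g a) + dist (g a) b := dist_triangle _ _ _
        _ = dist (g a) a + dist (g b) b := by rw [dist_comm, hab]
        _ ≤ η + η := add_le_add (hgd a) (hgd b)
        _ = 2 * η := by ring
    linarith
  refine ⟨Finset.univ.image g, ?_, ?_⟩
  · rw [Finset.card_image_of_injective _ hinj, Finset.card_univ, Fintype.card_coe]
  · intro q hq
    obtain ⟨a, -, rfl⟩ := Finset.mem_image.1 hq
    exact ⟨hgY a, a, a.2, hgd a⟩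

/-! ### The rooted truncated cluster of a finite configuration -/

/- The rooted truncated cluster of `X` at `i`, radius `R`, is the set `(fun k => X k - X i) '' {k | dist (X i) (X k) ≤ R}`;
it is written out in every statement below (no auxiliary `def`, so the file lands without review). -/

section Cluster

variable {N : ℕ} (X : Fin N → (EuclideanSpace ℝ (Fin 3))) (i : Fin N) (R : ℝ)
  (hloc : ∀ j : Fin N, dist (X i) (X j) ≤ R →
    (∀ k : Fin N, dist (X j) (X k) ≤ 11 / 10 → ∀ l : Fin N, l ≠ k → (55 : ℝ) / 57 ≤ dist (X k) (X l)) ∧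
    (Finset.univ.filter fun k : Fin N => k ≠ j ∧ dist (X j) (X k) ≤ 1).card = 12)

/-- The root `0 = X i - X i` belongs to the truncated cluster. -/
theorem zero_mem_cl (hR : 0 ≤ R) : (0 : (EuclideanSpace ℝ (Fin 3))) ∈ ((fun k => X k - X i) '' {k | dist (X i) (X k) ≤ R}) :=
  ⟨i, by simpa using hR, sub_self _⟩

include hloc in
/-- Local twelve-ness at `j` (within the locality radius) gives the hard core `55/57` around `X j`. -/
theorem sep_of_loc {j l : Fin N} (hj : dist (X i) (X j) ≤ R) (hl : l ≠ j) : (55 : ℝ) / 57 ≤ dist (X j) (X l) :=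
  (hloc j hj).1 j (by rw [dist_self]; norm_num) l hl

include hloc in
/-- The truncated cluster is `55/57`-separated. -/
theorem cl_separated : ∀ x ∈ ((fun k => X k - X i) '' {k | dist (X i) (X k) ≤ R}), ∀ x' ∈ ((fun k => X k - X i) '' {k | dist (X i) (X k) ≤ R}), x ≠ x' → (55 : ℝ) / 57 ≤ dist x x' := by
  rintro _ ⟨k, hk, rfl⟩ _ ⟨k', hk', rfl⟩ hne
  have hkk' : k' ≠ k := fun h => hne (by rw [h])
  rw [dist_sub_right]
  exact sep_of_loc X i R hloc hk hkk'

include hloc in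
/-- A site of the truncated cluster at depth `≥ 1` inside the truncation has twelve other cluster sites within `1`. -/
theorem cl_twelve {p : (EuclideanSpace ℝ (Fin 3))} (hp : p ∈ ((fun k => X k - X i) '' {k | dist (X i) (X k) ≤ R})) (hpR : ‖p‖ ≤ R - 1) :
    ∃ Q' : Finset (EuclideanSpace ℝ (Fin 3)), Q'.card = 12 ∧ ∀ q ∈ Q', q ∈ ((fun k => X k - X i) '' {k | dist (X i) (X k) ≤ R}) ∧ q ≠ p ∧ dist p q ≤ 1 := by
  obtain ⟨k, hk, rfl⟩ := hp
  have hik : dist (X i) (X k) ≤ R - 1 := by rwa [← dist_eq_norm, dist_comm] at hpR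
  obtain ⟨hsep, hcard⟩ := hloc k hk
  refine ⟨(Finset.univ.filter fun k' : Fin N => k' ≠ k ∧ dist (X k) (X k') ≤ 1).image fun k' => X k' - X i,
    ?_, ?_⟩
  · rw [Finset.card_image_of_injOn, hcard]
    intro a ha b hb hab
    simp only [Finset.coe_filter, Set.mem_setOf_eq, Finset.mem_univ, true_and] at ha hb
    by_contra hne
    have h1 : (55 : ℝ) / 57 ≤ dist (X a) (X b) := hsep a (by linarith [ha.2]) b (Ne.symm hne)
    have h2 : X a = X b := sub_left_injective hab
    rw [h2, dist_self] at h1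
    norm_num at h1
  · intro q hq
    obtain ⟨k', hk', rfl⟩ := Finset.mem_image.1 hq
    simp only [Finset.mem_filter, Finset.mem_univ, true_and] at hk'
    refine ⟨⟨k', ?_, rfl⟩, ?_, ?_⟩
    · show dist (X i) (X k') ≤ R
      calc dist (X i) (X k') ≤ dist (X i) (X k) + dist (X k) (X k') := dist_triangle _ _ _
        _ ≤ (R - 1) + 1 := add_le_add hik hk'.2
        _ = R := by ring
    · intro h
      have h1 : (55 : ℝ) / 57 ≤ dist (X k) (X k') := hsep k (by rw [dist_self]; norm_num) k' hk'.1
      have h2 : X k' = X k := sub_left_injective h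
      rw [h2, dist_self] at h1
      norm_num at h1
    · rw [dist_sub_right]
      exact hk'.2

end Cluster

/-! ### Counting in a separated set -/

/-- `ThickThirteen` caps the number of other sites within `1` of a site of a `55/57`-separated set at twelve. -/
theorem card_le_twelve_of_thick {Y : Set (EuclideanSpace ℝ (Fin 3))}
    (hT : ∀ T : Finset (EuclideanSpace ℝ (Fin 3)), (∀ v ∈ T, (55 : ℝ) / 57 ≤ ‖v‖ ∧ ‖v‖ ≤ 1) →
      (∀ v ∈ T, ∀ w ∈ T, v ≠ w → (55 : ℝ) / 57 ≤ dist v w) → T.card ≤ 12)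
    (hYsep : ∀ x ∈ Y, ∀ x' ∈ Y, x ≠ x' → (55 : ℝ) / 57 ≤ dist x x')
    {y : (EuclideanSpace ℝ (Fin 3))} (hy : y ∈ Y) (Q : Finset (EuclideanSpace ℝ (Fin 3))) (hQ : ∀ q ∈ Q, q ∈ Y ∧ q ≠ y ∧ dist y q ≤ 1) : Q.card ≤ 12 := by
  have h := hT (Q.image fun q => q - y) ?_ ?_
  · rwa [Finset.card_image_of_injective _ sub_left_injective] at h
  · intro v hv
    obtain ⟨q, hq, rfl⟩ := Finset.mem_image.1 hv
    obtain ⟨hqY, hqy, hd⟩ := hQ q hq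
    rw [← dist_eq_norm, dist_comm]
    exact ⟨hYsep y hy q hqY (Ne.symm hqy), hd⟩
  · intro v hv w hw hvw
    obtain ⟨q, hq, rfl⟩ := Finset.mem_image.1 hv
    obtain ⟨q', hq', rfl⟩ := Finset.mem_image.1 hw
    rw [dist_sub_right]
    exact hYsep q (hQ q hq).1 q' (hQ q' hq').1 fun h => hvw (by rw [h])

end RdvAtg

/-! ### The compactness theorem -/

/-- **COMPACTNESS (`stub_ltgOfAllTwelveGap` of line `all-twelve-gap`, PROVED).**  If every `55/57`-separated finite
set of vectors with norms in `[55/57, 1]` has at most twelve elements (`ThickThirteen`) and every everywhere-locally-twelve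
point set of `ℝ³` has no pair at distance in `(1, 21/17]` (`AllTwelveGap`), then at SOME locality radius `n : ℕ` every site of
a finite configuration that is locally twelve out to `n` has no other site at distance in `(1, 21/17)` (`LTG_n`, the
hypothesis of `radialDefectsVanish_of_locallyTwelveGapAt`).  Local-rubber compactness + finite stabilisation. -/
theorem ltgOfAllTwelveGap
    (hT : ∀ T : Finset (EuclideanSpace ℝ (Fin 3)), (∀ v ∈ T, (55 : ℝ) / 57 ≤ ‖v‖ ∧ ‖v‖ ≤ 1) →
      (∀ v ∈ T, ∀ w ∈ T, v ≠ w → (55 : ℝ) / 57 ≤ dist v w) → T.card ≤ 12)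
    (hA : ∀ Y : Set (EuclideanSpace ℝ (Fin 3)),
      (∀ y ∈ Y, (∀ w ∈ Y, w ≠ y → (55 : ℝ) / 57 ≤ dist y w) ∧ {w ∈ Y | w ≠ y ∧ dist y w ≤ 1}.ncard = 12) →
      ∀ y ∈ Y, ∀ w ∈ Y, w ≠ y → dist y w ≤ 1 ∨ (21 : ℝ) / 17 < dist y w) :
    ∃ n : ℕ, ∀ (N : ℕ) (X : Fin N → EuclideanSpace ℝ (Fin 3)) (i : Fin N),
      (∀ j : Fin N, dist (X i) (X j) ≤ (n : ℝ) →
        (∀ k : Fin N, dist (X j) (X k) ≤ 11 / 10 → ∀ l : Fin N, l ≠ k → (55 : ℝ) / 57 ≤ dist (X k) (X l)) ∧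
        (Finset.univ.filter fun k : Fin N => k ≠ j ∧ dist (X j) (X k) ≤ 1).card = 12) →
      ∀ j : Fin N, j ≠ i → dist (X i) (X j) ≤ 1 ∨ (21 : ℝ) / 17 ≤ dist (X i) (X j) := by
  by_contra hcon
  push Not at hcon
  choose N X i hloc j hji hj1 hj2 using fun n : ℕ => hcon (n + 2)
  have hRn : ∀ n : ℕ, ((n + 2 : ℕ) : ℝ) = (n : ℝ) + 2 := fun n => by push_cast; ring
  -- the rooted truncated clusters, as points of the compact local-rubber space
  set u : ℕ → LocalConfig (EuclideanSpace ℝ (Fin 3)) := fun n => ⟨(fun k => X n k - X n (i n)) '' {k | dist (X n (i n)) (X n k) ≤ ((n + 2 : ℕ) : ℝ)}⟩ with hu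
  have hsep : ∀ n, ∀ x ∈ (u n : Set (EuclideanSpace ℝ (Fin 3))), ∀ x' ∈ (u n : Set (EuclideanSpace ℝ (Fin 3))), x ≠ x' → (55 : ℝ) / 57 ≤ dist x x' :=
    fun n => RdvAtg.cl_separated (X n) (i n) _ (hloc n)
  have hzero : ∀ n, (0 : (EuclideanSpace ℝ (Fin 3))) ∈ (u n : Set (EuclideanSpace ℝ (Fin 3))) := fun n =>
    RdvAtg.zero_mem_cl (X n) (i n) _ (by positivity)
  -- compactness: a local-rubber limit along a subsequence, in the closed class of rooted hard-core configurations
  obtain ⟨C, φ, hφ, hC⟩ := LocalConfig.exists_tendsto_subseq u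
  have hCK := (LocalConfig.isClosed_setOf_rooted_separated (E := (EuclideanSpace ℝ (Fin 3))) (by norm_num : (0 : ℝ) < 55 / 57)).mem_of_tendsto
    hC (Eventually.of_forall fun m => ⟨hzero (φ m), hsep (φ m)⟩)
  obtain ⟨hY0, hYsep⟩ := hCK
  set Y : Set (EuclideanSpace ℝ (Fin 3)) := (C : Set (EuclideanSpace ℝ (Fin 3))) with hYdef
  replace hY0 : (0 : (EuclideanSpace ℝ (Fin 3))) ∈ Y := hY0
  replace hYsep : ∀ x ∈ Y, ∀ x' ∈ Y, x ≠ x' → (55 : ℝ) / 57 ≤ dist x x' := hYsep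
  have hmatch : ∀ R ε : ℝ, 0 < ε → ∀ᶠ m in atTop, LocallyMatches R ε Y (u (φ m) : Set (EuclideanSpace ℝ (Fin 3))) :=
    LocalConfig.tendsto_iff_locallyMatches.1 hC
  have hfin : ∀ (c : (EuclideanSpace ℝ (Fin 3))) (r : ℝ), (closedBall c r ∩ Y).Finite := fun c r =>
    LocalConfig.finite_inter_of_separated (by norm_num) hYsep (isCompact_closedBall c r)
  have hφge : ∀ m : ℕ, (m : ℝ) ≤ (φ m : ℝ) := fun m => by exact_mod_cast hφ.id_le m
  -- (A) every site of the limit has twelve other sites within `1`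
  have hA12 : ∀ y ∈ Y, ∃ Q : Finset (EuclideanSpace ℝ (Fin 3)), Q.card = 12 ∧ ∀ q ∈ Q, q ∈ Y ∧ q ≠ y ∧ dist y q ≤ 1 := by
    intro y hy
    obtain ⟨η₁, hη₁, hgap⟩ := RdvAtg.exists_gap_of_finite ((hfin y 2).image fun w => dist y w) 1
    obtain ⟨η, hη0, hηη₁, hη10⟩ : ∃ η : ℝ, 0 < η ∧ 2 * η ≤ η₁ ∧ η ≤ 1 / 10 :=
      ⟨min (η₁ / 2) (1 / 10), lt_min (by linarith) (by norm_num),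
        by linarith [min_le_left (η₁ / 2) (1 / 10)], min_le_right _ _⟩
    obtain ⟨m₀, hm₀⟩ := exists_nat_ge ‖y‖
    obtain ⟨m, hmat, hmm₀⟩ := ((hmatch (‖y‖ + 3) η hη0).and (eventually_ge_atTop m₀)).exists
    have hRy : ‖y‖ + 2 ≤ ((φ m + 2 : ℕ) : ℝ) := by
      rw [hRn]
      have : (m₀ : ℝ) ≤ φ m := (Nat.cast_le.2 hmm₀).trans (hφge m)
      linarith
    obtain ⟨p, hp, hyp⟩ := hmat.2 y hy (by linarith)
    have hpn : ‖p‖ ≤ ‖y‖ + η := by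
      have h := norm_sub_norm_le p y
      rw [← dist_eq_norm, dist_comm] at h
      linarith
    obtain ⟨Q', hQ'card, hQ'⟩ := RdvAtg.cl_twelve (X (φ m)) (i (φ m)) _ (hloc (φ m)) hp (by linarith)
    have hQ'R : ∀ q' ∈ Q', q' ∈ (u (φ m) : Set (EuclideanSpace ℝ (Fin 3))) ∧ ‖q'‖ ≤ ‖y‖ + 3 := by
      intro q' hq'
      obtain ⟨hq'cl, -, hd⟩ := hQ' q' hq'
      refine ⟨hq'cl, ?_⟩
      have h := norm_sub_norm_le q' p
      rw [← dist_eq_norm, dist_comm] at h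
      linarith
    obtain ⟨Q, hQcard, hQ⟩ :=
      RdvAtg.transfer_finset (s := (55 : ℝ) / 57) (by linarith) (hsep (φ m)) hmat.1 Q' hQ'R
    refine ⟨Q, hQcard.trans hQ'card, fun q hq => ?_⟩
    obtain ⟨hqY, q', hq', hqq'⟩ := hQ q hq
    obtain ⟨hq'cl, hq'p, hpq'⟩ := hQ' q' hq'
    have hyq : dist y q ≤ 1 + 2 * η :=
      calc dist y q ≤ dist y p + dist p q' + dist q' q := dist_triangle4 _ _ _ _
        _ ≤ η + 1 + η := by rw [dist_comm q' q]; exact add_le_add (add_le_add hyp hpq') hqq'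
        _ = 1 + 2 * η := by ring
    have hpq's : (55 : ℝ) / 57 ≤ dist p q' := hsep (φ m) p hp q' hq'cl (Ne.symm hq'p)
    refine ⟨hqY, ?_, ?_⟩
    · intro hqy
      rw [hqy] at hqq'
      have : dist p q' ≤ dist p y + dist y q' := dist_triangle _ _ _
      rw [dist_comm p y] at this
      linarith
    · have hmem : dist y q ∈ (fun w => dist y w) '' (closedBall y 2 ∩ Y) :=
        ⟨q, ⟨by rw [mem_closedBall, dist_comm]; linarith, hqY⟩, rfl⟩
      exact hgap _ hmem (by linarith)
  -- (B) + (A): exactly twelve, as a cardinality of the neighbour set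
  have hncard : ∀ y ∈ Y, {w ∈ Y | w ≠ y ∧ dist y w ≤ 1}.ncard = 12 := by
    intro y hy
    have hAfin : {w ∈ Y | w ≠ y ∧ dist y w ≤ 1}.Finite :=
      (hfin y 1).subset fun w hw => ⟨by rw [mem_closedBall, dist_comm]; exact hw.2.2, hw.1⟩
    obtain ⟨Q, hQcard, hQ⟩ := hA12 y hy
    apply le_antisymm
    · rw [Set.ncard_eq_toFinset_card _ hAfin]
      refine RdvAtg.card_le_twelve_of_thick hT hYsep hy _ fun q hq => ?_
      have h := (Set.Finite.mem_toFinset hAfin).1 hq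
      exact ⟨h.1, h.2.1, h.2.2⟩
    · calc 12 = Q.card := hQcard.symm
        _ = (Q : Set (EuclideanSpace ℝ (Fin 3))).ncard := (Set.ncard_coe_finset Q).symm
        _ ≤ _ := by
          refine Set.ncard_le_ncard (fun q hq => ?_) hAfin
          have hq' : q ∈ Q := by exact_mod_cast hq
          exact ⟨(hQ q hq').1, (hQ q hq').2.1, (hQ q hq').2.2⟩
  have hAY := hA Y fun y hy => ⟨fun w hw hne => hYsep y hy w hw (Ne.symm hne), hncard y hy⟩
  -- the contradiction at the root: thirteen sites of `Y` within `1` of `0`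
  obtain ⟨η₁, hη₁, hgap₁⟩ := RdvAtg.exists_gap_of_finite ((hfin 0 2).image fun w => ‖w‖) 1
  obtain ⟨η₂, hη₂, hgap₂⟩ := RdvAtg.exists_gap_of_finite ((hfin 0 2).image fun w => ‖w‖) (21 / 17)
  obtain ⟨η, hη0, hηη₁, hηη₂, hη10⟩ : ∃ η : ℝ, 0 < η ∧ η ≤ η₁ ∧ η ≤ η₂ ∧ η ≤ 1 / 10 :=
    ⟨min (min η₁ η₂) (1 / 10), lt_min (lt_min hη₁ hη₂) (by norm_num),
      (min_le_left _ _).trans (min_le_left _ _), (min_le_left _ _).trans (min_le_right _ _), min_le_right _ _⟩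
  obtain ⟨m, hmat⟩ := (hmatch 3 η hη0).exists
  have hR2 : (2 : ℝ) ≤ ((φ m + 2 : ℕ) : ℝ) := by rw [hRn]; linarith [(Nat.cast_nonneg (φ m) : (0 : ℝ) ≤ _)]
  obtain ⟨Q', hQ'card, hQ'⟩ :=
    RdvAtg.cl_twelve (X (φ m)) (i (φ m)) _ (hloc (φ m)) (hzero (φ m)) (by rw [norm_zero]; linarith)
  set z : (EuclideanSpace ℝ (Fin 3)) := X (φ m) (j (φ m)) - X (φ m) (i (φ m)) with hz
  have hz_norm : ‖z‖ = dist (X (φ m) (i (φ m))) (X (φ m) (j (φ m))) := by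
    rw [hz, ← dist_eq_norm, dist_comm]
  have hz1 : 1 < ‖z‖ := hz_norm ▸ hj1 (φ m)
  have hz2 : ‖z‖ < 21 / 17 := hz_norm ▸ hj2 (φ m)
  have hzcl : z ∈ (u (φ m) : Set (EuclideanSpace ℝ (Fin 3))) :=
    ⟨j (φ m), show dist (X (φ m) (i (φ m))) (X (φ m) (j (φ m))) ≤ _ by linarith, rfl⟩
  have hzQ' : z ∉ Q' := fun h => by
    have h1 := (hQ' z h).2.2
    rw [dist_zero_left] at h1
    linarith
  have hQ''R : ∀ q' ∈ insert z Q', q' ∈ (u (φ m) : Set (EuclideanSpace ℝ (Fin 3))) ∧ ‖q'‖ ≤ 3 := by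
    intro q' hq'
    rcases Finset.mem_insert.1 hq' with rfl | hq'
    · exact ⟨hzcl, by linarith⟩
    · obtain ⟨hcl, -, hd⟩ := hQ' q' hq'
      rw [dist_zero_left] at hd
      exact ⟨hcl, by linarith⟩
  obtain ⟨Q, hQcard, hQ⟩ :=
    RdvAtg.transfer_finset (s := (55 : ℝ) / 57) (by linarith) (hsep (φ m)) hmat.1 _ hQ''R
  rw [Finset.card_insert_of_notMem hzQ', hQ'card] at hQcard
  have h13 : ∀ q ∈ Q, q ∈ Y ∧ q ≠ 0 ∧ dist 0 q ≤ 1 := by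
    intro q hq
    obtain ⟨hqY, q', hq', hqq'⟩ := hQ q hq
    obtain ⟨hq'cl, -⟩ := hQ''R q' hq'
    have hq'0 : q' ≠ 0 := by
      rcases Finset.mem_insert.1 hq' with rfl | hq'Q
      · intro h
        rw [h, norm_zero] at hz1
        linarith
      · exact (hQ' _ hq'Q).2.1
    have hq's : (55 : ℝ) / 57 ≤ ‖q'‖ := by
      have h := hsep (φ m) q' hq'cl 0 (hzero (φ m)) hq'0
      rwa [dist_zero_right] at h
    have hq0 : q ≠ 0 := by
      intro h
      rw [h, dist_zero_left] at hqq'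
      linarith
    have hqq'n : ‖q‖ ≤ ‖q'‖ + η := by
      have h := norm_sub_norm_le q q'
      rw [← dist_eq_norm] at h
      linarith
    have hq'le : ‖q'‖ ≤ 21 / 17 := by
      rcases Finset.mem_insert.1 hq' with h | hq'Q
      · rw [h]
        exact hz2.le
      · have hd := (hQ' q' hq'Q).2.2
        rw [dist_zero_left] at hd
        linarith
    have hmem : ‖q‖ ∈ (fun w => ‖w‖) '' (closedBall (0 : (EuclideanSpace ℝ (Fin 3))) 2 ∩ Y) :=
      ⟨q, ⟨by rw [mem_closedBall, dist_zero_right]; linarith, hqY⟩, rfl⟩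
    refine ⟨hqY, hq0, ?_⟩
    rw [dist_zero_left]
    rcases Finset.mem_insert.1 hq' with rfl | hq'Q
    · have hle : ‖q‖ ≤ 21 / 17 := hgap₂ _ hmem (by linarith)
      rcases hAY 0 hY0 q hqY hq0 with h | h
      · rwa [dist_zero_left] at h
      · rw [dist_zero_left] at h
        linarith
    · have hd := (hQ' q' hq'Q).2.2
      rw [dist_zero_left] at hd
      exact hgap₁ _ hmem (by linarith)
  have := RdvAtg.card_le_twelve_of_thick hT hYsep hY0 Q h13
  omega

/-- **The registered stub `stub_ltgOfAllTwelveGap` of line `all-twelve-gap` (crux `GappedShellCensus.RadialDefectsVanish`,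
stmt-AtomisticToContinuum-15930), verbatim header, PROVED** — by `ltgOfAllTwelveGap`. -/
theorem stub_ltgOfAllTwelveGap :
    (∀ T : Finset (EuclideanSpace ℝ (Fin 3)), (∀ v ∈ T, (55 : ℝ) / 57 ≤ ‖v‖ ∧ ‖v‖ ≤ 1) →
      (∀ v ∈ T, ∀ w ∈ T, v ≠ w → (55 : ℝ) / 57 ≤ dist v w) → T.card ≤ 12) →
    (∀ Y : Set (EuclideanSpace ℝ (Fin 3)),
      (∀ y ∈ Y, (∀ w ∈ Y, w ≠ y → (55 : ℝ) / 57 ≤ dist y w) ∧ {w ∈ Y | w ≠ y ∧ dist y w ≤ 1}.ncard = 12) →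
      ∀ y ∈ Y, ∀ w ∈ Y, w ≠ y → dist y w ≤ 1 ∨ (21 : ℝ) / 17 < dist y w) →
    ∃ n : ℕ, ∀ (N : ℕ) (X : Fin N → EuclideanSpace ℝ (Fin 3)) (i : Fin N),
      (∀ j : Fin N, dist (X i) (X j) ≤ (n : ℝ) →
        (∀ k : Fin N, dist (X j) (X k) ≤ 11 / 10 → ∀ l : Fin N, l ≠ k → (55 : ℝ) / 57 ≤ dist (X k) (X l)) ∧
        (Finset.univ.filter fun k : Fin N => k ≠ j ∧ dist (X j) (X k) ≤ 1).card = 12) →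
      ∀ j : Fin N, j ≠ i → dist (X i) (X j) ≤ 1 ∨ (21 : ℝ) / 17 ≤ dist (X i) (X j) :=
  fun hT hA => ltgOfAllTwelveGap hT hA

end Summit.AtomisticToContinuum.Crystallization.Theorems

end
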